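import Summits.CriticalPhenomena.PercolationContinuityZ3.Theorems.PercNearOneGluingNoHeavyQuantHeavySingleTools
import HarnessLib

/-!
# QUANT lane R8, T-DEC: THE SYMMETRIC TRIPLE — three IDENTICAL composite siblings (the shape of the lane's minimal open instance,
# "three 2-chains", README V393) are SDEC given the oracle, for EVERY root gate `q ∈ (1/3, 1)`, at any floor with the explicit slack
# `φ(q)` — by a TWO-COMPONENT re-hung certificate; and why the true floor resists (arm-1 gen 53, architect)

builds on p205010 (kernel theorem, internal audit signed; external expert review pending)

Support file (`--supports stmt-CriticalPhenomena-4575`), QUANT lane seat prim-quant-arm-1 (gen 53, architect); memo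
`run/shared/lean/prim/quant/prim-quant-arm-1-g53/ARCH-G53.md` §2c.  Theorems only, standard axioms, no sorries.  Uses census-1 g25's generating
polynomials (`…QuantURPMLaw`: `lawPoly`, `lawPoly_gate`, `lawPoly_lconv`, `lawPoly_flaw`, `coeff_lawPoly`) and the oracle tools of
`…QuantThreeRootGenericStep/Oracle` (`decAtT_gate_of_sdec`, `treeBuiltN_gate_le`).

SETTING.  `L = [t, t, t]`: three copies of one tree-built composite sibling (`Sib.TreeOK x`: root gate `q`, opened sub-forest `ρ` at floor `x₁`, mean
`m`).  No sibling is heavy (`fQ [t,t] = 2q − q² > q`), so the heavy-single route (`…QuantHeavySingleStep/Mixture`) does not apply; light roots (typer g39)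
cover `q ≤ 1/3`.  Since the blocks are identical, the forest's count law is determined by the law of the NUMBER of open roots `Bin(3,q)`, and a
common-target oracle certificate is a mixture of tree ARRANGEMENTS of the three whole blocks (at least one attachment gate sure or absent — the gate
budget) whose open-block counts have mean `3q` and mix to `Bin(3,q)` — a 2-dimensional convex-hull problem in `(P(0 open), P(3 open))`.
TWO CLOSED-FORM CERTIFICATES (exact; `explore/sym3_regime2_check.py`):
* `q ∈ (1/2, 1)` (regime AC): `t∗t∗t = (1−q)²·gate_q(ρ∗ρ∗ρ) + q(2−q)·[gate_{e₂}(ρ ∗ gate_{e₃}ρ) ∗ ρ]` — the MERGED triple (two blocks surely attached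
  under the third's root) and the CHAIN with one block opened — where `(2−q)e₂e₃ = 2q−1`, `(2−q)(1−e₂) = 3(1−q)²` (so `e₂ + e₂e₃ = 3q − 1`: both
  components have mean `3qm`); explicitly `e₂ = (−3q²+5q−1)/(2−q)`, `e₃ = (2q−1)/((2−q)e₂)`.
* `q ∈ (1/3, 1/2]` (regime EF): `t∗t∗t = α·[ρ ∗ gate_{3q−1}ρ] + (1−α)·gate_g(ρ∗ρ ∗ gate_{e₃}ρ)` — one block opened beside one re-gated (third
  absent), and the merged pair gated with the third hung below — where `α(2−3q) = 3q(1−q)²`, `(1−α)(1−g) = (1−q)³`, `(1−α)g e₃ = q³`,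
  `α(3q−1) + (1−α)g(1−e₃) = 3q²(1−q)`.
THE THEOREMS (`flaw_symTriple_eq_mixAC/EF`, **`sdec_symTriple_AC/EF`**): given the oracle below `fgates [t,t,t]`, parameters in `(0,1]` with these
relations, and the FLOOR SLACK `x ≤ e₂e₃·x₁` (AC) / `x ≤ (3q−1)·x₁ ∧ x ≤ g e₃·x₁` (EF) — the deepest re-hung block must respect the forest floor —
`SDEC x (ftop [t,t,t]) (flaw [t,t,t])`.  The slack factor `e₂e₃/q` rises from `1/8` at `q = .55` to `1` as `q → 1`; `(3q−1)/q` from `0` at `q = 1/3` to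
`1` at `q = 1/2`, where regime EF holds AT THE TRUE FLOOR.  WHY THE TRUE FLOOR RESISTS ELSEWHERE (memo §2c, pen): at `x = q·x₁` every present block needs
effective openness `≥ q`, which with mean `3q` forces all three present blocks to openness exactly `q`; the only legal such arrangements are the merged
triple `(1−q, q)`, the split `B(q) + 2B(q)` `((1−q)², q²)` and (for `q ≤ 2/3`) two-block laws on the axis `P(3) = 0`, whose hull misses
`((1−q)³, q³)` except at `q = 1/2` — so at the true floor NO common-target oracle mixture exists for the symmetric triple: the instance needs per-layer
(torque) arguments there.

HONEST STATUS.  An explicit width-3 family with floor slack; the symmetric triple AT ITS TRUE FLOOR (q ≠ 1/2), `SiblingStep`, `GateStepN`,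
`LightResidDECOracle`, `FarTreeRow` remain OPEN; RATE class (log\*) and the honest sentence of `run/shared/lean/prim/quant/README.md` unchanged.
[this work]; generating polynomials: prim-quant-census-1 g25; oracle pattern: prim-quant-arm-1 g46 / lead g42; RCM components: lead g42 (README V394).
Nothing here is cited as a published result.  The gluing rows served [cite: KozmaNitzan2024, Conjecture 3 (p. 15)]; product measure
[cite: Grimmett1999, §1.3 p. 10].
-/

noncomputable section

open scoped BigOperators
open Polynomial

namespace Summit.CriticalPhenomena.PercolationContinuityZ3.Theorems
namespace Quant
namespace LawDec

open Finset

/-! ### Generating-polynomial tools -/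

/-- `lawPoly` of a two-term combination. [this work] -/
theorem lawPoly_lin (M : ℕ) (a b : ℝ) (μ ν : ℕ → ℝ) :
    lawPoly M (fun k => a * μ k + b * ν k) = C a * lawPoly M μ + C b * lawPoly M ν := by
  unfold lawPoly
  simp only [map_add, map_mul, add_mul, Finset.sum_add_distrib, Finset.mul_sum, mul_assoc]

/-- raising the truncation top of a law vanishing above `M` does not change `lawPoly`. [this work] -/
theorem lawPoly_top_of_le (M M' : ℕ) (μ : ℕ → ℝ) (hMM : M ≤ M') (hμ : ∀ h, M < h → μ h = 0) : lawPoly M' μ = lawPoly M μ := by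
  ext k
  rw [coeff_lawPoly, coeff_lawPoly]
  by_cases hk : k ≤ M
  · rw [if_pos hk, if_pos (hk.trans hMM)]
  · rw [if_neg hk]
    split_ifs
    · exact hμ k (not_le.1 hk)
    · rfl

/-- two laws vanishing above `M` with the same `lawPoly M` are equal. [this work] -/
theorem eq_of_lawPoly_eq (M : ℕ) (μ ν : ℕ → ℝ) (hμ : ∀ h, M < h → μ h = 0) (hν : ∀ h, M < h → ν h = 0)
    (h : lawPoly M μ = lawPoly M ν) : μ = ν := by
  funext k
  by_cases hk : k ≤ M
  · have e := congrArg (fun p : ℝ[X] => p.coeff k) h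
    simp only [coeff_lawPoly, if_pos hk] at e
    exact e
  · rw [hμ k (not_le.1 hk), hν k (not_le.1 hk)]

/-- a gated law vanishes where the law does, away from `0`. [this work] -/
theorem gate_eq_zero_above (μ : ℕ → ℝ) (q : ℝ) (M : ℕ) (hμ : ∀ h, M < h → μ h = 0) (h : ℕ) (hh : M < h) : gate μ q h = 0 := by
  rw [gate_apply, hμ h hh, if_neg (by omega)]; ring

/-- the forest law of the triple at the symmetric tops. [this work] -/
theorem ftop_three (t : Sib) : ftop [t, t, t] = t.M + t.M + t.M := by
  simp only [ftop]; omega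

/-- the generating polynomial of the symmetric triple. [this work] -/
theorem lawPoly_flaw_three (t : Sib) :
    lawPoly (t.M + t.M + t.M) (flaw [t, t, t]) = (C t.q * lawPoly t.M t.ρ + C (1 - t.q)) ^ 3 := by
  rw [← ftop_three, lawPoly_flaw]
  simp only [List.map_cons, List.map_nil, List.prod_cons, List.prod_nil, sibPoly]
  ring

/-! ### Regime AC (`q > 1/2`): the merged triple and the chain -/

/-- **THE AC IDENTITY**: `t∗t∗t = (1−q)²·gate_q(ρ∗ρ∗ρ) + (1 − (1−q)²)·[gate_{e₂}(ρ ∗ gate_{e₃}ρ) ∗ ρ]` whenever `(2−q)e₂e₃ = 2q−1` and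
`(2−q)(1−e₂) = 3(1−q)²`. [this work] -/
theorem flaw_symTriple_eq_mixAC (t : Sib) (e₂ e₃ : ℝ)
    (h1 : (2 - t.q) * (e₂ * e₃) = 2 * t.q - 1) (h2 : (2 - t.q) * (1 - e₂) = 3 * (1 - t.q) ^ 2) :
    flaw [t, t, t] = fun h => (1 - t.q) ^ 2 * gate (lconv (t.M + t.M) t.M (lconv t.M t.M t.ρ t.ρ) t.ρ) t.q h
      + (1 - (1 - t.q) ^ 2) * lconv (t.M + t.M) t.M (gate (lconv t.M t.M t.ρ (gate t.ρ e₃)) e₂) t.ρ h := by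
  apply eq_of_lawPoly_eq (t.M + t.M + t.M)
  · intro h hh; exact flaw_eq_zero_of_lt [t, t, t] h (by rw [ftop_three]; exact hh)
  · intro h hh
    rw [gate_eq_zero_above _ _ _ (fun k hk => lconv_eq_zero _ _ _ _ k hk) h hh, lconv_eq_zero _ _ _ _ h hh]
    ring
  rw [lawPoly_flaw_three, lawPoly_lin, lawPoly_gate, lawPoly_lconv, lawPoly_lconv, lawPoly_lconv, lawPoly_gate, lawPoly_lconv, lawPoly_gate]
  simp only [map_sub, map_pow, map_one]
  set P : ℝ[X] := lawPoly t.M t.ρ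
  have h1P := congrArg Polynomial.C h1
  have h2P := congrArg Polynomial.C h2
  simp only [map_mul, map_sub, map_pow, map_one, map_ofNat] at h1P h2P
  linear_combination (-(C t.q) * P ^ 3 + C t.q * P ^ 2) * h1P + (C t.q * P ^ 2 - C t.q * P) * h2P

/-- **THE SYMMETRIC TRIPLE, REGIME AC.**  Floor `0 < x < 1`, a tree-built composite sibling `t` (root gate `q`), the oracle below `fgates [t,t,t]`,
parameters `0 < e₂ ≤ 1`, `0 < e₃ ≤ 1` with `(2−q)e₂e₃ = 2q−1`, `(2−q)(1−e₂) = 3(1−q)²` (solvable for every `q > 1/2`, explicit formulas in the module docstring), and the floor slack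
`x ≤ e₂e₃·x₁` ⟹ `SDEC x (ftop [t,t,t]) (flaw [t,t,t])`. [this work] -/
theorem sdec_symTriple_AC {x : ℝ} (hx0 : 0 < x) (hx1 : x < 1) (t : Sib) (ht : t.TreeOK x)
    (hO : ∀ (x' : ℝ) (n' M' : ℕ) (μ' : ℕ → ℝ), n' < fgates [t, t, t] → TreeBuiltN x' n' M' μ' → SDEC x' M' μ')
    (e₂ e₃ : ℝ) (he₂0 : 0 < e₂) (he₂1 : e₂ ≤ 1) (he₃0 : 0 < e₃) (he₃1 : e₃ ≤ 1)
    (h1 : (2 - t.q) * (e₂ * e₃) = 2 * t.q - 1) (h2 : (2 - t.q) * (1 - e₂) = 3 * (1 - t.q) ^ 2)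
    (hxs : x ≤ e₂ * e₃ * t.x₁) : SDEC x (ftop [t, t, t]) (flaw [t, t, t]) := by
  intro a ha0 ha1 j hj
  obtain ⟨hq0, hq1, hxq, hT, _⟩ := ht
  obtain ⟨hx₁0, hx₁1, ρ0, ρM, ρ1, ρta⟩ := hT.lawFacts
  have hfg : fgates [t, t, t] = 3 * t.n + 3 := by simp only [fgates]; omega
  set z : ℝ := a * x with hzdef
  have hz0 : 0 < z := mul_pos ha0 hx0
  have hz1 : z < 1 := by rw [hzdef]; exact mul_lt_one_aux ha1 hx0.le hx1
  -- the relations give the common mean factor `1 + e₂ + e₂ e₃ = 3q`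
  have h2q : 0 < 2 - t.q := by linarith
  have hsum : e₂ + e₂ * e₃ = 3 * t.q - 1 := by
    have : (2 - t.q) * (e₂ + e₂ * e₃) = (2 - t.q) * (3 * t.q - 1) := by linear_combination h1 - h2
    exact mul_left_cancel₀ h2q.ne' this
  set m : ℝ := t.mean with hmdef
  have hmean : ∑ h ∈ Finset.range (t.M + 1), (h : ℝ) * t.ρ h = m := rfl
  -- component A: the merged triple `gate_q(ρ∗ρ∗ρ)`, tree-built at floor `q x₁` with `3 t.n + 1` gates
  have hA3 : TreeBuiltN t.x₁ (t.n + t.n + t.n) (t.M + t.M + t.M) (lconv (t.M + t.M) t.M (lconv t.M t.M t.ρ t.ρ) t.ρ) :=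
    TreeBuiltN.conv (TreeBuiltN.conv hT hT) hT
  have hA : TreeBuiltN (t.q * t.x₁) (t.n + t.n + t.n + 1) (t.M + t.M + t.M)
      (gate (lconv (t.M + t.M) t.M (lconv t.M t.M t.ρ t.ρ) t.ρ) t.q) := TreeBuiltN.gate t.q hq0 hq1 hA3
  have hSA := hO _ _ _ _ (by rw [hfg]; omega) hA
  obtain ⟨_, _, A0, AM, A1, Ata⟩ := hA.lawFacts
  obtain ⟨_, _, _, _, A31, _⟩ := hA3.lawFacts
  have hAmean : ∑ h ∈ Finset.range (t.M + t.M + t.M + 1), (h : ℝ) * gate (lconv (t.M + t.M) t.M (lconv t.M t.M t.ρ t.ρ) t.ρ) t.q h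
      = t.q * (3 * m) := by
    rw [sum_mul_gate, sum_mul_lconv _ _ _ _ (sum_lconv _ _ _ _ ρ1 ρ1) ρ1, sum_mul_lconv _ _ _ _ ρ1 ρ1, hmean]; ring
  have dA : DECAtT z (a * (t.q * (3 * m))) j (t.M + t.M + t.M)
      (gate (gate (lconv (t.M + t.M) t.M (lconv t.M t.M t.ρ t.ρ) t.ρ) t.q) a) := by
    have hqx1 : t.q * t.x₁ < 1 := mul_lt_one_aux hq1.le hx₁0.le hx₁1
    have := decAtT_gate_of_sdec (t.M + t.M + t.M) _ (t.q * t.x₁) a z (by positivity) ha0 ha1 (mul_lt_one_aux ha1 (by positivity) hqx1)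
      (by rw [hzdef]; exact mul_le_mul_of_nonneg_left hxq ha0.le) A0 AM A1 Ata hSA j
    rwa [hAmean] at this
  -- component C: the chain `gate_{e₂}(ρ ∗ gate_{e₃}ρ) ∗ ρ`, tree-built at floor `e₂ e₃ x₁` with at most `3 t.n + 2` gates
  have hv0 : 0 < e₂ * e₃ * t.x₁ := by positivity
  obtain ⟨n₃, hn₃, hG₃⟩ := treeBuiltN_gate_le (e₃ * t.x₁) e₃ t.n t.M t.ρ he₃0 he₃1
    (by rw [mul_div_cancel_left₀ _ he₃0.ne']; exact hT)
  have he23 : e₂ * e₃ ≤ 1 := mul_le_one₀ he₂1 he₃0.le he₃1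
  have hI : TreeBuiltN (e₃ * t.x₁) (t.n + n₃) (t.M + t.M) (lconv t.M t.M t.ρ (gate t.ρ e₃)) :=
    TreeBuiltN.conv (TreeBuiltN.mono hT (by positivity) (mul_le_of_le_one_left hx₁0.le he₃1)) hG₃
  obtain ⟨n₂, hn₂, hG₂⟩ := treeBuiltN_gate_le (e₂ * e₃ * t.x₁) e₂ (t.n + n₃) (t.M + t.M) _ he₂0 he₂1
    (by rw [show e₂ * e₃ * t.x₁ / e₂ = e₃ * t.x₁ by field_simp]; exact hI)
  have hCt : TreeBuiltN (e₂ * e₃ * t.x₁) (n₂ + t.n) (t.M + t.M + t.M)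
      (lconv (t.M + t.M) t.M (gate (lconv t.M t.M t.ρ (gate t.ρ e₃)) e₂) t.ρ) :=
    TreeBuiltN.conv hG₂ (TreeBuiltN.mono hT hv0 (mul_le_of_le_one_left hx₁0.le he23))
  have hSC := hO _ _ _ _ (by rw [hfg]; omega) hCt
  obtain ⟨_, _, C0, CM, C1, Cta⟩ := hCt.lawFacts
  obtain ⟨g₃0, g₃M, g₃1⟩ := gate_laws t.M t.ρ e₃ he₃0.le he₃1 ρ0 ρM ρ1
  obtain ⟨g₂0, g₂M, g₂1⟩ := gate_laws (t.M + t.M) _ e₂ he₂0.le he₂1 (lconv_nonneg _ _ _ _ ρ0 g₃0)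
    (fun h hh => lconv_eq_zero _ _ _ _ h hh) (sum_lconv _ _ _ _ ρ1 g₃1)
  have hCmean : ∑ h ∈ Finset.range (t.M + t.M + t.M + 1), (h : ℝ) *
      lconv (t.M + t.M) t.M (gate (lconv t.M t.M t.ρ (gate t.ρ e₃)) e₂) t.ρ h = t.q * (3 * m) := by
    rw [sum_mul_lconv _ _ _ _ g₂1 ρ1, sum_mul_gate, sum_mul_lconv _ _ _ _ ρ1 g₃1, sum_mul_gate, hmean]
    have : e₂ * (m + e₃ * m) + m = (1 + (e₂ + e₂ * e₃)) * m := by ring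
    rw [this, hsum]; ring
  have dC : DECAtT z (a * (t.q * (3 * m))) j (t.M + t.M + t.M)
      (gate (lconv (t.M + t.M) t.M (gate (lconv t.M t.M t.ρ (gate t.ρ e₃)) e₂) t.ρ) a) := by
    have hv1 : e₂ * e₃ * t.x₁ < 1 := mul_lt_one_aux he23 hx₁0.le hx₁1
    have := decAtT_gate_of_sdec (t.M + t.M + t.M) _ (e₂ * e₃ * t.x₁) a z hv0.le ha0 ha1 (mul_lt_one_aux ha1 hv0.le hv1)
      (by rw [hzdef]; exact mul_le_mul_of_nonneg_left hxs ha0.le) C0 CM C1 Cta hSC j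
    rwa [hCmean] at this
  -- the mixture
  set w : ℝ := (1 - t.q) ^ 2 with hwdef
  have hw0 : 0 ≤ w := by positivity
  have hw1 : w ≤ 1 := by rw [hwdef]; exact pow_le_one₀ (by linarith) (by linarith)
  have mix := decAtT_mixture w hw0 hw1 dA dC
  have eF := flaw_symTriple_eq_mixAC t e₂ e₃ h1 h2
  have e : gate (flaw [t, t, t]) a = fun h => w * gate (gate (lconv (t.M + t.M) t.M (lconv t.M t.M t.ρ t.ρ) t.ρ) t.q) a h
      + (1 - w) * gate (lconv (t.M + t.M) t.M (gate (lconv t.M t.M t.ρ (gate t.ρ e₃)) e₂) t.ρ) a h := by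
    funext h
    rw [eF]
    simp only [gate_apply]
    ring
  have hL : ∀ s ∈ [t, t, t], s.LawOK := by
    intro s hs; simp only [List.mem_cons, List.mem_nil_iff, or_false, or_self] at hs; subst hs; exact ⟨hq0, hq1, ρ0, ρM, ρ1⟩
  obtain ⟨_, _, _, tmn⟩ := flaw_facts [t, t, t] hL
  have hEmean : ∑ h ∈ Finset.range (ftop [t, t, t] + 1), (h : ℝ) * gate (flaw [t, t, t]) a h = a * (t.q * (3 * m)) := by
    rw [sum_mul_gate, tmn]; simp only [fmean]; rw [hmdef]; ring
  rw [decAt_iff_decAtT, hEmean, e, ftop_three]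
  exact mix

/-! ### Regime EF (`1/3 < q ≤ 1/2`): one opened block beside a re-gated one, and the gated merged pair with the third hung below -/

/-- **THE EF IDENTITY**: `t∗t∗t = α·[ρ ∗ gate_{3q−1}ρ] + (1−α)·gate_g(ρ∗ρ ∗ gate_{e₃}ρ)` under the four coefficient relations. [this work] -/
theorem flaw_symTriple_eq_mixEF (t : Sib) (α g e₃ : ℝ)
    (r3 : (1 - α) * (g * e₃) = t.q ^ 3) (r2 : α * (3 * t.q - 1) + (1 - α) * (g * (1 - e₃)) = 3 * t.q ^ 2 * (1 - t.q))
    (r1 : α * (2 - 3 * t.q) = 3 * t.q * (1 - t.q) ^ 2) (r0 : (1 - α) * (1 - g) = (1 - t.q) ^ 3) :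
    flaw [t, t, t] = fun h => α * lconv t.M t.M t.ρ (gate t.ρ (3 * t.q - 1)) h
      + (1 - α) * gate (lconv (t.M + t.M) t.M (lconv t.M t.M t.ρ t.ρ) (gate t.ρ e₃)) g h := by
  apply eq_of_lawPoly_eq (t.M + t.M + t.M)
  · intro h hh; exact flaw_eq_zero_of_lt [t, t, t] h (by rw [ftop_three]; exact hh)
  · intro h hh
    rw [lconv_eq_zero _ _ _ _ h (by omega), gate_eq_zero_above _ _ _ (fun k hk => lconv_eq_zero _ _ _ _ k hk) h hh]
    ring
  rw [lawPoly_flaw_three, lawPoly_lin, lawPoly_top_of_le (t.M + t.M) (t.M + t.M + t.M) _ (by omega) (fun k hk => lconv_eq_zero _ _ _ _ k hk),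
    lawPoly_lconv, lawPoly_gate, lawPoly_gate, lawPoly_lconv, lawPoly_lconv, lawPoly_gate]
  simp only [map_mul, map_sub, map_one, map_ofNat]
  set P : ℝ[X] := lawPoly t.M t.ρ
  have r3P := congrArg Polynomial.C r3
  have r2P := congrArg Polynomial.C r2
  have r1P := congrArg Polynomial.C r1
  have r0P := congrArg Polynomial.C r0
  simp only [map_mul, map_sub, map_add, map_pow, map_one, map_ofNat] at r3P r2P r1P r0P
  linear_combination (-P ^ 3) * r3P + (-P ^ 2) * r2P + (-P) * r1P + (-1 : ℝ[X]) * r0P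

/-- **THE SYMMETRIC TRIPLE, REGIME EF.**  Floor `0 < x < 1`, a tree-built composite sibling `t` (root gate `q > 1/3`), the oracle below
`fgates [t,t,t]`, parameters `α ∈ [0,1]`, `0 < g ≤ 1`, `0 < e₃ ≤ 1`, `3q − 1 ≤ 1` with the four coefficient relations (solvable for every
`1/3 < q ≤ 1/2`, memo §2c), and the floor slack `x ≤ (3q−1)·x₁`, `x ≤ g·e₃·x₁` ⟹ `SDEC x (ftop [t,t,t]) (flaw [t,t,t])`; at `q = 1/2` (`α = 3/4`, `g = 1/2`,
`e₃ = 1`) this is the TRUE floor. [this work] -/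
theorem sdec_symTriple_EF {x : ℝ} (hx0 : 0 < x) (hx1 : x < 1) (t : Sib) (ht : t.TreeOK x)
    (hO : ∀ (x' : ℝ) (n' M' : ℕ) (μ' : ℕ → ℝ), n' < fgates [t, t, t] → TreeBuiltN x' n' M' μ' → SDEC x' M' μ')
    (α g e₃ : ℝ) (hα0 : 0 ≤ α) (hα1 : α ≤ 1) (hg0 : 0 < g) (hg1 : g ≤ 1) (he₃0 : 0 < e₃) (he₃1 : e₃ ≤ 1)
    (hq3 : 1 < 3 * t.q) (hq3' : 3 * t.q - 1 ≤ 1)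
    (r3 : (1 - α) * (g * e₃) = t.q ^ 3) (r2 : α * (3 * t.q - 1) + (1 - α) * (g * (1 - e₃)) = 3 * t.q ^ 2 * (1 - t.q))
    (r1 : α * (2 - 3 * t.q) = 3 * t.q * (1 - t.q) ^ 2) (r0 : (1 - α) * (1 - g) = (1 - t.q) ^ 3)
    (hxE : x ≤ (3 * t.q - 1) * t.x₁) (hxF : x ≤ g * e₃ * t.x₁) : SDEC x (ftop [t, t, t]) (flaw [t, t, t]) := by
  intro a ha0 ha1 j hj
  obtain ⟨hq0, hq1, hxq, hT, _⟩ := ht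
  obtain ⟨hx₁0, hx₁1, ρ0, ρM, ρ1, ρta⟩ := hT.lawFacts
  have hfg : fgates [t, t, t] = 3 * t.n + 3 := by simp only [fgates]; omega
  set z : ℝ := a * x with hzdef
  have hz0 : 0 < z := mul_pos ha0 hx0
  have hz1 : z < 1 := by rw [hzdef]; exact mul_lt_one_aux ha1 hx0.le hx1
  set m : ℝ := t.mean with hmdef
  have hmean : ∑ h ∈ Finset.range (t.M + 1), (h : ℝ) * t.ρ h = m := rfl
  -- the common mean: E has `(1 + (3q−1))m = 3qm`, F has `g(2 + e₃)m = 3qm` (from r3, r0: (1−α)g(2+e₃) = ... )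
  have hē0 : 0 < 3 * t.q - 1 := by linarith
  -- component E: `ρ ∗ gate_{3q−1} ρ` (third block absent), tree-built at floor `(3q−1)x₁` with at most `2 t.n + 1` gates, top `2M ≤ 3M`
  have hvE0 : 0 < (3 * t.q - 1) * t.x₁ := by positivity
  obtain ⟨nE, hnE, hGE⟩ := treeBuiltN_gate_le ((3 * t.q - 1) * t.x₁) (3 * t.q - 1) t.n t.M t.ρ hē0 hq3'
    (by rw [mul_div_cancel_left₀ _ hē0.ne']; exact hT)
  have hEt : TreeBuiltN ((3 * t.q - 1) * t.x₁) (t.n + nE) (t.M + t.M) (lconv t.M t.M t.ρ (gate t.ρ (3 * t.q - 1))) :=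
    TreeBuiltN.conv (TreeBuiltN.mono hT hvE0 (mul_le_of_le_one_left hx₁0.le hq3')) hGE
  have hSE := hO _ _ _ _ (by rw [hfg]; omega) hEt
  obtain ⟨_, _, E0, EM, E1, Eta⟩ := hEt.lawFacts
  obtain ⟨gE0, gEM, gE1⟩ := gate_laws t.M t.ρ (3 * t.q - 1) hē0.le hq3' ρ0 ρM ρ1
  have hEmeanE : ∑ h ∈ Finset.range (t.M + t.M + 1), (h : ℝ) * lconv t.M t.M t.ρ (gate t.ρ (3 * t.q - 1)) h = t.q * (3 * m) := by
    rw [sum_mul_lconv _ _ _ _ ρ1 gE1, sum_mul_gate, hmean]; ring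
  have dE : DECAtT z (a * (t.q * (3 * m))) j (t.M + t.M + t.M) (gate (lconv t.M t.M t.ρ (gate t.ρ (3 * t.q - 1))) a) := by
    have hv1 : (3 * t.q - 1) * t.x₁ < 1 := mul_lt_one_aux hq3' hx₁0.le hx₁1
    have := decAtT_gate_of_sdec (t.M + t.M) _ ((3 * t.q - 1) * t.x₁) a z hvE0.le ha0 ha1 (mul_lt_one_aux ha1 hvE0.le hv1)
      (by rw [hzdef]; exact mul_le_mul_of_nonneg_left hxE ha0.le) E0 EM E1 Eta hSE j
    rw [hEmeanE] at this
    exact decAtT_mono_top this (by omega)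
  -- component F: `gate_g(ρ∗ρ ∗ gate_{e₃}ρ)`, tree-built at floor `g e₃ x₁` with at most `3 t.n + 2` gates
  have hvF0 : 0 < g * e₃ * t.x₁ := by positivity
  obtain ⟨n₃, hn₃, hG₃⟩ := treeBuiltN_gate_le (e₃ * t.x₁) e₃ t.n t.M t.ρ he₃0 he₃1
    (by rw [mul_div_cancel_left₀ _ he₃0.ne']; exact hT)
  have hF3 : TreeBuiltN (e₃ * t.x₁) (t.n + t.n + n₃) (t.M + t.M + t.M)
      (lconv (t.M + t.M) t.M (lconv t.M t.M t.ρ t.ρ) (gate t.ρ e₃)) :=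
    TreeBuiltN.conv (TreeBuiltN.mono (TreeBuiltN.conv hT hT) (by positivity) (mul_le_of_le_one_left hx₁0.le he₃1)) hG₃
  have hge : g * e₃ ≤ 1 := mul_le_one₀ hg1 he₃0.le he₃1
  obtain ⟨nF, hnF, hFt⟩ := treeBuiltN_gate_le (g * e₃ * t.x₁) g (t.n + t.n + n₃) (t.M + t.M + t.M) _ hg0 hg1
    (by rw [show g * e₃ * t.x₁ / g = e₃ * t.x₁ by field_simp]; exact hF3)
  have hSF := hO _ _ _ _ (by rw [hfg]; omega) hFt
  obtain ⟨_, _, F0, FM, F1, Fta⟩ := hFt.lawFacts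
  obtain ⟨g₃0, g₃M, g₃1⟩ := gate_laws t.M t.ρ e₃ he₃0.le he₃1 ρ0 ρM ρ1
  have h1α : 0 < 1 - α := by
    by_contra hle
    have hα : α = 1 := le_antisymm hα1 (by linarith)
    rw [hα, sub_self, zero_mul] at r3
    have : 0 < t.q ^ 3 := by positivity
    linarith
  have hgsum : g * (2 + e₃) = 3 * t.q := by
    -- from r0 and r3: (1−α)(g(2+e₃)) = (1−α) − (1−q)³ ... use (1-α) g = (1-α) - (1-q)^3 and (1-α) g e₃ = q³ and r1 for α
    have e1 : (1 - α) * g = (1 - α) - (1 - t.q) ^ 3 := by linear_combination -(r0)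
    have key : (1 - α) * (g * (2 + e₃)) = (1 - α) * (3 * t.q) := by linear_combination 2 * e1 + r3 - r1
    exact mul_left_cancel₀ h1α.ne' key
  have hFmean : ∑ h ∈ Finset.range (t.M + t.M + t.M + 1), (h : ℝ) *
      gate (lconv (t.M + t.M) t.M (lconv t.M t.M t.ρ t.ρ) (gate t.ρ e₃)) g h = t.q * (3 * m) := by
    rw [sum_mul_gate, sum_mul_lconv _ _ _ _ (sum_lconv _ _ _ _ ρ1 ρ1) g₃1, sum_mul_lconv _ _ _ _ ρ1 ρ1, sum_mul_gate, hmean]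
    have : g * (m + m + e₃ * m) = (g * (2 + e₃)) * m := by ring
    rw [this, hgsum]; ring
  have dF : DECAtT z (a * (t.q * (3 * m))) j (t.M + t.M + t.M)
      (gate (gate (lconv (t.M + t.M) t.M (lconv t.M t.M t.ρ t.ρ) (gate t.ρ e₃)) g) a) := by
    have hv1 : g * e₃ * t.x₁ < 1 := mul_lt_one_aux hge hx₁0.le hx₁1
    have := decAtT_gate_of_sdec (t.M + t.M + t.M) _ (g * e₃ * t.x₁) a z hvF0.le ha0 ha1 (mul_lt_one_aux ha1 hvF0.le hv1)
      (by rw [hzdef]; exact mul_le_mul_of_nonneg_left hxF ha0.le) F0 FM F1 Fta hSF j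
    rwa [hFmean] at this
  -- the mixture
  have mix := decAtT_mixture α hα0 hα1 dE dF
  have eFid := flaw_symTriple_eq_mixEF t α g e₃ r3 r2 r1 r0
  have e : gate (flaw [t, t, t]) a = fun h => α * gate (lconv t.M t.M t.ρ (gate t.ρ (3 * t.q - 1))) a h
      + (1 - α) * gate (gate (lconv (t.M + t.M) t.M (lconv t.M t.M t.ρ t.ρ) (gate t.ρ e₃)) g) a h := by
    funext h
    rw [eFid]
    simp only [gate_apply]
    ring
  have hL : ∀ s ∈ [t, t, t], s.LawOK := by
    intro s hs; simp only [List.mem_cons, List.mem_nil_iff, or_false, or_self] at hs; subst hs; exact ⟨hq0, hq1, ρ0, ρM, ρ1⟩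
  obtain ⟨_, _, _, tmn⟩ := flaw_facts [t, t, t] hL
  have hEmean : ∑ h ∈ Finset.range (ftop [t, t, t] + 1), (h : ℝ) * gate (flaw [t, t, t]) a h = a * (t.q * (3 * m)) := by
    rw [sum_mul_gate, tmn]; simp only [fmean]; rw [hmdef]; ring
  rw [decAt_iff_decAtT, hEmean, e, ftop_three]
  exact mix

end LawDec
end Quant
end Summit.CriticalPhenomena.PercolationContinuityZ3.Theorems
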